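import Literature.MathematicalPhysics.QuantumFieldTheory.Balaban1983to89.B1Eq221GaussStep
import Literature.Probability.Distributions.GaussianQuadraticTilt

/-!
# `Balaban1983to89.B1Eq221Dictionary` — T. Bałaban, *(Higgs)₂,₃ quantum fields in a finite volume. I. A lower bound*, Commun. Math. Phys. **85** (1982) 603–626 [Balaban1982Higgs1]: (2.19) → (2.21) and (2.18) IN INTEGRATION COORDINATES — the Gaussian-integral ↦ Schur-complement DICTIONARY: the form the integral delivers IS `B1RG242.StepData.Δk` (2.21) (resp. `β·1 − β²·QC^{(k)}Q^*` = `display221_succ` one level up), the constant IS `B1Eq239Normalization.zConst` ((3.31)/(3.32)), the stationary point IS the background field (3.29)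

statement-level skeleton of published theorems with citation tags; proofs where landed; nothing here is a claim about the Yang–Mills mass gap

PDF held: `paper:balaban1982-cmp85-higgs23-i` (journal page = PDF page + 602); pp. 604, 610, 614, 617 [PDF 2, 8, 12, 15]
read AS IMAGES from the ×2 renders `run/shared/lean/pub/pub-balaban/b2b-balaban-ref1/pages/1982-cmp85-higgs23-I/` of
the cell `pub-balaban`.

CITATION HEADER (lean-in-tree rule) — WHAT IS REPRODUCED.  Cell `lit-balaban`, Phase-2 proof seat p34 (gen 3); companion
of `B1Eq221GaussStep` (same seat: the integral on r14's `B1RT` carriers); free target of SKELETON rows **B1.Eq2.17** /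
**B1.Eq2.21** (owner r14).  p. 610, verbatim: *"Defining the propagator G^ε_k(Ω,A) = (−Δ^{ε,N}_{A,Ω} + m² +
a_k(L^kε)^{−2}P_k(A))^{−1}, P_k(A) = Q^*_k(A)Q_k(A), (2.20) and calculating the integral in (2.19), we obtain
⟨ψ,Δ^{(k),L^kε}(Ω,A)ψ⟩ = a_k(L^kε)^{−2}⟨ψ,ψ⟩ − a_k²(L^kε)^{−4}⟨ψ,Q_k(A)G^ε_k(Ω,A)Q^*_k(A)ψ⟩. (2.21)"*, where (2.19) is
*"Z^ε_k(Ω,A) exp(−½⟨ψ,Δ^{(k),L^kε}(Ω,A)ψ⟩) = T^ε_{a_k,L^k,A}[Ω, exp(−½⟨φ,(−Δ^{ε,N}_{A,Ω}+m²)φ⟩)]"* and (2.18)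
*"Z^{(k),L^kε}(Ω,A) exp(−½⟨ψ,Δ^{(k+1),L^{k+1}ε}(Ω,A)ψ⟩) = T^{L^kε}_{a,L,A}[Ω^{(k)}, exp(−½⟨φ,Δ^{(k),L^kε}(Ω,A)φ⟩)]"*; the
kernel (2.10) p. 609 *"t^ε_{a_k,L^k,A}(ψ(y),φ↾_{B^k(y)}) = (a_k(L^kε)^{d−2}/2π)^{N/2} exp(−½a_k(L^kε)^{d−2}|ψ(y) −
(Q_k(A)φ)(y)|²)"*; the scalar products, p. 604: *"⟨f,g⟩ = Σ_{x∈T_ε} ε^d f(x)·g(x) (1.5) … The adjoint operators with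
respect to the scalar product (1.5) can be easily written up"*; p. 617: *"A^{(k),ε} = a_k(L^kε)^{−2}G^ε_kQ^*_kA, φ^{(k),ε} =
a_k(L^kε)^{−2}G^ε_k(A^{(k),ε})Q^*_k(A^{(k),ε})φ (3.29)"* and *"Z_k(A^{(k),ε}) = (a_k(L^kε)^{d−2}/2π)^{(N/2)|T^{(k)}_1|} ∫dφ
exp(−½⟨φ,(G^ε_k(A^{(k),ε}))^{−1}φ⟩) (3.32)"*.

WHY THIS FILE.  `B1RG242` DEFINES `StepData.Δk := α·1 − α²·Q_kG_kQ^*_k` ((2.21) read as a definition) and labels «NOT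
CERTIFIED … (i) the Gaussian-integral ↦ Schur-complement dictionary»; `B1Eq239Normalization` (p15) defines the closed form
`zConst` and labels «(i) The identification of §1's `normConst` (an integral over `X → V` …) with §3's `zConst` (an integral
over `ι → ℝ`) … (ii) (2.21) itself is not re-derived».  Here, in the integration coordinates these modules use (`ι → ℝ` fine
variables with weight matrix `WE` ↤ ⟨·,·⟩_ε, `κ → ℝ` block variables with scalar weight `wK` ↤ (L^kε)^d), the integral
(2.19) is COMPUTED and both identifications are PROVED; the companion `B1Eq221GaussStep` does the same computation on the
`B1RT` carriers, and §3 below transports its intrinsic form `schurForm` to these coordinates under any linear, block-isometric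
coordinate dictionary (the measure-free half of p15's item (i); the measure-preserving coordinates for the constants are not
constructed here).

DICTIONARY (print ↦ Lean).  `WE` ↤ the matrix of ⟨·,·⟩_ε on the fine variables (p15: `WE`; `B1RG242.StepData.ScalarProducts`);
`wK` ↤ (L^kε)^d, the (uniform) weight of ⟨·,·⟩_{L^kε}, so that the kernel constant of (2.10) is `a_k(L^kε)^{d−2} = α·wK` with
`α = S.α` ↤ a_k(L^kε)^{−2} (p15's convention in `zConst_display239`); `S : B1RG242.StepData ℝ ι κ ν` ↤ (H, Q_k, Q^*_k, Q, Q^*, α, β);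
the adjointness of p. 604 in matrix form `WE * S.Qks = wK • S.Qkᵀ` (`adj_matrix_of_forall` derives it from the `ScalarProducts.adjk`
form); `coordExp c K M y x` ↤ twice the exponent of the (2.19) integrand, `c|y − Kx|² + xᵀMx` (c ↤ α·wK, K ↤ Q_k, M ↤ WE·H);
`coordA` ↤ its xx-matrix `M + cKᵀK = WE(H + αP_k) = WE·(G^ε_k)^{−1}`; `coordSchur` ↤ `c|y|² − c²(Kᵀy)ᵀA^{−1}(Kᵀy)`.

WHAT IS KERNEL-CHECKED (0 sorry; axioms ⊆ {propext, Classical.choice, Quot.sound}).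
 §1 (ℝ^ι Gaussian, by name from `Literature.Probability.Distributions.GaussianQuadraticTilt` — completing the square + the
    closed form): `integral_exp_coordExp`: `∫ exp(−½·coordExp) dx = (∫ exp(−½xᵀAx) dx) · exp(−½·coordSchur)` for A positive
    definite; the coordinate minimiser `c·A^{−1}Kᵀy` solves `Ax = cKᵀy` (`coordA_mulVec_minimiser`).
 §2 THE DICTIONARY: `coordSchur_eq` — `coordSchur (α·wK) Q_k (WE·H) ψ = wK·ψᵀ(α·1 − α²·Q_k(H + αQ^*_kQ_k)^{−1}Q^*_k)ψ =
    ⟨ψ,Δ^{(k)}ψ⟩_{L^kε}` (2.21), from `WE·Q^*_k = wK·Q_kᵀ` and `wK·(WE(H+αP_k))^{−1}Q_kᵀ = G^ε_kQ^*_k` (`smul_inv_mul_transpose`);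
    `minimiser_eq_background` — the minimiser is `α·G^ε_kQ^*_kψ` (3.29); **`gaussStep`** / **`display219`** — (2.19) COMPUTED:
    `(α·wK/2π)^{|κ|/2} ∫ exp(−½α·wK|ψ − Q_kφ|²)·exp(−½φᵀWE·Hφ) dφ = zConst (α·wK) |κ| (WE(H + αP_k)) · exp(−½·wK·ψᵀ S.Δk ψ)` —
    i.e. `Z^ε_k = zConst …` (p15's first factor in `zConst_display239`, = (3.32)) AND `Δ^{(k)} = StepData.Δk` (2.21), under
    `WE(H + αP_k)` positive definite (`display219_of_scalarProducts`: adjointness taken from `StepData.ScalarProducts` with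
    `WK = wK·1`); **`display218`** — (2.18) COMPUTED the same way one level up: constant `zConst (β·wM) |ν| (wK(βP + Δ^{(k)}))`
    (p15's second factor) and form `wM·ψᵀ(β·1 − β²·QC^{(k)}Q^*)ψ`, which **`display218_221`** rewrites, by `B1RG242`'s
    `display221_succ`, as `wM·ψᵀ(γ·1 − γ²·Q_{k+1}G_{k+1}Q^*_{k+1})ψ` = (2.21) at k + 1 — the consistency of the inductive
    definition (2.18) with (2.21) now holds for the COMPUTED integrals, not only for the defined matrices.
 §3 the coordinate-free ↔ coordinate bridge for the forms (`CoordDict`: linear coordinates `e` of `X → V`, block-isometric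
    `f` of `Y → V`, `K`, `M` the transported block average and form): `jointExp = coordExp`, `jointA = ·ᵀcoordA·`,
    `source = c(Kᵀfψ)·e(·)`; a `B1Eq221GaussStep.IsStationary` point has coordinates the coordinate minimiser
    (`CoordDict.coord_of_isStationary`, e surjective, A positive definite) and **`CoordDict.schurForm_eq`**:
    `B1Eq221GaussStep.schurForm κ q ψ φ₀ = coordSchur κ K M (f ψ)` — so the exponential factors of
    `B1Eq221GaussStep.rtOp_gaussDensity_eq_of_isStationary` and of `gaussStep` agree.
HONEST SCOPE.  (i) Hypotheses are adjointness + positive definiteness of `WE(H + αP_k)` (as in p15's `zConst_display239`);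
nothing is asserted about Bałaban's concrete operators.  (ii) The identification of the CONSTANTS across the two carriers
(`B1RT.rtOp … 0` on `X → V` versus `zConst` on `ι → ℝ`) needs measure-preserving linear coordinates `(X → V) ≃ (X × Fin N → ℝ)`
and is NOT done here (p15's item (i), constants half; p15's §1 treats the constants at operator level independently).
(iii) Uniform block weight `wK` (the printed case (1.5)); a non-uniform block weight would change the kernel (2.10) itself.
Value = kernel certificate that `B1RG242`'s defined `Δk`, `Ck`-form and p15's `zConst` ARE what the integrals (2.18)/(2.19)
produce; NOT summit progress.
-/

open scoped BigOperators Matrix InnerProductSpace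
open _root_.MeasureTheory _root_.Real Matrix

namespace Literature.MathematicalPhysics.QuantumFieldTheory.Balaban1983to89.B1Eq221Dictionary

/-! ## §1  The (2.19) integrand in coordinates and its Gaussian integral (completing the square on `ι → ℝ`) -/

section Coordinates

variable {ι κ : Type*} [Fintype ι] [Fintype κ] [DecidableEq ι] [DecidableEq κ]

/-- Twice the exponent of the (2.19) integrand in coordinates: `c|y − Kx|² + xᵀMx` (c ↤ a_k(L^kε)^{d−2}, K ↤ Q_k(A), M ↤ the
matrix `WE·H` of ⟨φ,(−Δ^{ε,N}_{A,Ω}+m²)φ⟩_ε, y ↤ ψ, x ↤ φ). [cite: Balaban1982Higgs1, (2.10) p.609, (2.19) p.610] -/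
def coordExp (c : ℝ) (K : Matrix κ ι ℝ) (M : Matrix ι ι ℝ) (y : κ → ℝ) (x : ι → ℝ) : ℝ :=
  c * ((y - K *ᵥ x) ⬝ᵥ (y - K *ᵥ x)) + x ⬝ᵥ M *ᵥ x

/-- The xx-matrix of `coordExp`: `M + cKᵀK` (↤ `WE·(H + a_k(L^kε)^{−2}P_k) = WE·(G^ε_k)^{−1}`, (2.20)).
[cite: Balaban1982Higgs1, (2.20) p.610] -/
def coordA (c : ℝ) (K : Matrix κ ι ℝ) (M : Matrix ι ι ℝ) : Matrix ι ι ℝ := M + c • (Kᵀ * K)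

/-- The Schur complement value `c|y|² − c²(Kᵀy)ᵀ(M + cKᵀK)^{−1}(Kᵀy)` — what «calculating the integral in (2.19)» leaves in
the exponent (`= ⟨ψ,Δ^{(k)}ψ⟩_{L^kε}` by `coordSchur_eq`). [cite: Balaban1982Higgs1, (2.21) p.610] -/
noncomputable def coordSchur (c : ℝ) (K : Matrix κ ι ℝ) (M : Matrix ι ι ℝ) (y : κ → ℝ) : ℝ :=
  c * (y ⬝ᵥ y) - c ^ 2 * ((Kᵀ *ᵥ y) ⬝ᵥ (coordA c K M)⁻¹ *ᵥ (Kᵀ *ᵥ y))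

omit [DecidableEq ι] [DecidableEq κ] in
/-- Expansion of the joint exponent: `coordExp = xᵀAx − 2(cKᵀy)·x + c|y|²`. [cite: Balaban1982Higgs1, (2.19)–(2.20) p.610] -/
theorem coordExp_eq (c : ℝ) (K : Matrix κ ι ℝ) (M : Matrix ι ι ℝ) (y : κ → ℝ) (x : ι → ℝ) :
    coordExp c K M y x
      = x ⬝ᵥ (coordA c K M) *ᵥ x - 2 * ((c • (Kᵀ *ᵥ y)) ⬝ᵥ x) + c * (y ⬝ᵥ y) := by
  unfold coordExp coordA
  have h1 : (y - K *ᵥ x) ⬝ᵥ (y - K *ᵥ x) = y ⬝ᵥ y - 2 * ((Kᵀ *ᵥ y) ⬝ᵥ x) + x ⬝ᵥ (Kᵀ * K) *ᵥ x := by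
    rw [Beta.GaussianIntegral.dotProduct_transpose_mul_self_mulVec, Matrix.mulVec_transpose,
      ← Matrix.dotProduct_mulVec, sub_dotProduct, dotProduct_sub, dotProduct_sub,
      dotProduct_comm (K *ᵥ x) y]
    ring
  rw [h1, Matrix.add_mulVec, dotProduct_add, Matrix.smul_mulVec, dotProduct_smul, smul_dotProduct,
    smul_eq_mul, smul_eq_mul]
  ring

omit [DecidableEq κ] in
/-- **«calculating the integral in (2.19)» in coordinates**: for `A = M + cKᵀK` positive definite,
`∫ exp(−½·coordExp(y,x)) dx = (∫ exp(−½xᵀAx) dx) · exp(−½·coordSchur(y))` — completing the square and translation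
invariance of Lebesgue measure on `ι → ℝ` (the tree's `Literature.Probability.Distributions.integral_exp_neg_half_quadratic_add_linear`,
by name). [cite: Balaban1982Higgs1, (2.19)–(2.21) p.610, (3.10)–(3.11) p.614] -/
theorem integral_exp_coordExp {c : ℝ} {K : Matrix κ ι ℝ} {M : Matrix ι ι ℝ} (hA : (coordA c K M).PosDef)
    (y : κ → ℝ) :
    ∫ x : ι → ℝ, Real.exp (-(1 / 2 : ℝ) * coordExp c K M y x)
      = (∫ x : ι → ℝ, Real.exp (-(1 / 2 : ℝ) * (x ⬝ᵥ (coordA c K M) *ᵥ x)))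
          * Real.exp (-(1 / 2 : ℝ) * coordSchur c K M y) := by
  set A := coordA c K M with hAdef
  set b : ι → ℝ := c • (Kᵀ *ᵥ y) with hb
  have hpt : ∀ x : ι → ℝ, Real.exp (-(1 / 2 : ℝ) * coordExp c K M y x)
      = Real.exp (-(x ⬝ᵥ A *ᵥ x) / 2 + b ⬝ᵥ x) * Real.exp (-(1 / 2 : ℝ) * (c * (y ⬝ᵥ y))) := by
    intro x
    rw [coordExp_eq, ← Real.exp_add]
    congr 1
    ring
  simp_rw [hpt]
  rw [integral_mul_const, Literature.Probability.Distributions.integral_exp_neg_half_quadratic_add_linear hA b,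
    ← Literature.Probability.Distributions.integral_exp_neg_half_quadratic hA]
  have hq : ∀ x : ι → ℝ, Real.exp (-(x ⬝ᵥ A *ᵥ x) / 2) = Real.exp (-(1 / 2 : ℝ) * (x ⬝ᵥ A *ᵥ x)) := by
    intro x; congr 1; ring
  simp_rw [hq]
  rw [mul_assoc, ← Real.exp_add]
  congr 2
  have hbb : b ⬝ᵥ A⁻¹ *ᵥ b = c ^ 2 * ((Kᵀ *ᵥ y) ⬝ᵥ A⁻¹ *ᵥ (Kᵀ *ᵥ y)) := by
    rw [hb, Matrix.mulVec_smul, dotProduct_smul, smul_dotProduct, smul_eq_mul, smul_eq_mul]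
    ring
  rw [hbb, coordSchur]
  ring

omit [DecidableEq κ] in
/-- The coordinate minimiser `x₀ = c·A^{−1}Kᵀy` solves the Euler–Lagrange equation `Ax₀ = cKᵀy` of the joint exponent
(the translation (3.10)). [cite: Balaban1982Higgs1, (3.10) p.614] -/
theorem coordA_mulVec_minimiser {c : ℝ} {K : Matrix κ ι ℝ} {M : Matrix ι ι ℝ} (hA : (coordA c K M).PosDef)
    (y : κ → ℝ) :
    coordA c K M *ᵥ (c • ((coordA c K M)⁻¹ *ᵥ (Kᵀ *ᵥ y))) = c • (Kᵀ *ᵥ y) := by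
  have hu : IsUnit (coordA c K M).det := isUnit_iff_ne_zero.mpr hA.det_pos.ne'
  rw [Matrix.mulVec_smul, Matrix.mulVec_mulVec, Matrix.mul_nonsing_inv _ hu, Matrix.one_mulVec]

/-! ## §2  The dictionary to `B1RG242.StepData` (2.20)/(2.21) and `B1Eq239Normalization.zConst` (3.31)/(3.32) -/

omit [DecidableEq ι] in
/-- The adjointness of p. 604 («The adjoint operators with respect to the scalar product (1.5)») in MATRIX form: if
`⟨φ, Q^*_kψ⟩_ε = ⟨Q_kφ, ψ⟩_{L^kε}` with ⟨u,v⟩_ε = uᵀWEv and the uniform block weight wK, then `WE·Q^*_k = wK·Q_kᵀ`.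
[cite: Balaban1982Higgs1, (1.5) p.604] -/
theorem adj_matrix_of_forall {WE : Matrix ι ι ℝ} {Qk : Matrix κ ι ℝ} {Qks : Matrix ι κ ℝ} {wK : ℝ}
    (h : ∀ φ ψ, φ ⬝ᵥ (WE *ᵥ (Qks *ᵥ ψ)) = (Qk *ᵥ φ) ⬝ᵥ (wK • ψ)) : WE * Qks = wK • Qkᵀ := by
  refine Matrix.toLin'.injective (LinearMap.ext fun ψ => ?_)
  simp only [Matrix.toLin'_apply]
  refine dotProduct_eq _ _ fun φ => ?_
  have h1 : (WE * Qks) *ᵥ ψ ⬝ᵥ φ = φ ⬝ᵥ (WE *ᵥ (Qks *ᵥ ψ)) := by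
    rw [dotProduct_comm, Matrix.mulVec_mulVec]
  have h2 : (wK • Qkᵀ) *ᵥ ψ ⬝ᵥ φ = (Qk *ᵥ φ) ⬝ᵥ (wK • ψ) := by
    rw [Matrix.smul_mulVec, smul_dotProduct, dotProduct_smul, Matrix.mulVec_transpose,
      ← Matrix.dotProduct_mulVec, dotProduct_comm]
  rw [h1, h2, h φ ψ]

omit [Fintype κ] [DecidableEq κ] in
/-- If `WE·B` is positive definite then `WE` and `B` are invertible (determinants). [folklore] -/
private theorem isUnit_det_of_posDef_mul {WE B : Matrix ι ι ℝ} (h : (WE * B).PosDef) :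
    IsUnit WE.det ∧ IsUnit B.det := by
  have hd : (WE * B).det ≠ 0 := h.det_pos.ne'
  rw [Matrix.det_mul] at hd
  exact ⟨isUnit_iff_ne_zero.mpr (left_ne_zero_of_mul hd), isUnit_iff_ne_zero.mpr (right_ne_zero_of_mul hd)⟩

omit [Fintype κ] [DecidableEq κ] in
/-- The inverse identity behind (2.21): `wK·(WE·B)^{−1}Q_kᵀ = B^{−1}Q^*_k` (B ↤ H + αP_k, so `B^{−1}Q^*_k = G^ε_kQ^*_k`), from
`WE·Q^*_k = wK·Q_kᵀ`. [cite: Balaban1982Higgs1, (2.20)–(2.21) p.610] -/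
theorem smul_inv_mul_transpose {WE B : Matrix ι ι ℝ} {Qk : Matrix κ ι ℝ} {Qks : Matrix ι κ ℝ} {wK : ℝ}
    (hadj : WE * Qks = wK • Qkᵀ) (hWE : IsUnit WE.det) :
    wK • ((WE * B)⁻¹ * Qkᵀ) = B⁻¹ * Qks := by
  rw [Matrix.mul_inv_rev, ← Matrix.mul_smul, ← hadj, Matrix.mul_assoc, ← Matrix.mul_assoc WE⁻¹,
    Matrix.nonsing_inv_mul _ hWE, Matrix.one_mul]

/-- **(2.21) IDENTIFIED**: the Schur complement value of the (2.19) exponent IS `⟨ψ,Δ^{(k)}ψ⟩_{L^kε}` with Δ^{(k)} =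
`α·1 − α²·Q_kG^ε_kQ^*_k` (= `B1RG242.StepData.Δk`): `coordSchur (α·wK) Q_k (WE·H) ψ = wK · ψᵀ(α·1 − α²·Q_k(H + αQ^*_kQ_k)^{−1}Q^*_k)ψ`.
[cite: Balaban1982Higgs1, (2.20)–(2.21) p.610] -/
theorem coordSchur_eq {WE H : Matrix ι ι ℝ} {Qk : Matrix κ ι ℝ} {Qks : Matrix ι κ ℝ} {α wK : ℝ}
    (hadj : WE * Qks = wK • Qkᵀ) (hWE : IsUnit WE.det) (ψ : κ → ℝ) :
    coordSchur (α * wK) Qk (WE * H) ψ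
      = wK * (ψ ⬝ᵥ (α • (1 : Matrix κ κ ℝ) - α ^ 2 • (Qk * (H + α • (Qks * Qk))⁻¹ * Qks)) *ᵥ ψ) := by
  have hA : coordA (α * wK) Qk (WE * H) = WE * (H + α • (Qks * Qk)) := by
    unfold coordA
    rw [Matrix.mul_add, Matrix.mul_smul, ← Matrix.mul_assoc, hadj, Matrix.smul_mul, smul_smul]
  have hG : (H + α • (Qks * Qk))⁻¹ * Qks = wK • ((WE * (H + α • (Qks * Qk)))⁻¹ * Qkᵀ) :=
    (smul_inv_mul_transpose hadj hWE).symm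
  unfold coordSchur
  rw [hA, Matrix.mul_assoc Qk, hG]
  rw [Matrix.sub_mulVec, Matrix.smul_mulVec, Matrix.smul_mulVec, Matrix.one_mulVec, dotProduct_sub,
    dotProduct_smul, dotProduct_smul, Matrix.mul_smul, Matrix.smul_mulVec, dotProduct_smul,
    ← Matrix.mulVec_mulVec, ← Matrix.mulVec_mulVec, Matrix.dotProduct_mulVec ψ Qk,
    ← Matrix.mulVec_transpose]
  simp only [smul_eq_mul]
  ring

omit [DecidableEq κ] in
/-- **(3.29) IDENTIFIED**: the coordinate minimiser `(α·wK)·(WE(H + αP_k))^{−1}Q_kᵀψ` of the (2.19) exponent is the background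
field `α·G^ε_kQ^*_kψ = a_k(L^kε)^{−2}G^ε_kQ^*_kψ`. [cite: Balaban1982Higgs1, (3.29) p.617] -/
theorem minimiser_eq_background {WE H : Matrix ι ι ℝ} {Qk : Matrix κ ι ℝ} {Qks : Matrix ι κ ℝ} {α wK : ℝ}
    (hadj : WE * Qks = wK • Qkᵀ) (hWE : IsUnit WE.det) (ψ : κ → ℝ) :
    (α * wK) • ((WE * (H + α • (Qks * Qk)))⁻¹ *ᵥ (Qkᵀ *ᵥ ψ))
      = α • (((H + α • (Qks * Qk))⁻¹ * Qks) *ᵥ ψ) := by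
  rw [← smul_inv_mul_transpose (B := H + α • (Qks * Qk)) hadj hWE, Matrix.smul_mulVec,
    ← Matrix.mulVec_mulVec, smul_smul]

/-- **THE GAUSSIAN STEP (2.19) COMPUTED, in coordinates**: with the kernel (2.10) of constant `c = α·wK` and the density
`exp(−½φᵀ(WE·H)φ)`, under the adjointness `WE·Q^*_k = wK·Q_kᵀ` and positive definiteness of `WE(H + αP_k)`:
`(c/2π)^{|κ|/2} ∫ exp(−½c|ψ − Q_kφ|²) exp(−½φᵀWE·Hφ) dφ = zConst c |κ| (WE(H + αP_k)) · exp(−½·wK·ψᵀ(α·1 − α²Q_kG_kQ^*_k)ψ)`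
— `Z^ε_k` of (2.19)/(3.32) = p15's `zConst`, and the form (2.21). [cite: Balaban1982Higgs1, (2.19)–(2.21) p.610, (3.32) p.617] -/
theorem gaussStep (WE H : Matrix ι ι ℝ) (Qk : Matrix κ ι ℝ) (Qks : Matrix ι κ ℝ) {α wK : ℝ}
    (hadj : WE * Qks = wK • Qkᵀ) (hpos : (WE * (H + α • (Qks * Qk))).PosDef) (ψ : κ → ℝ) :
    (α * wK / (2 * π)) ^ ((Fintype.card κ : ℝ) / 2)
        * ∫ φ : ι → ℝ, Real.exp (-(1 / 2 : ℝ) * ((α * wK) * ((ψ - Qk *ᵥ φ) ⬝ᵥ (ψ - Qk *ᵥ φ))))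
            * Real.exp (-(1 / 2 : ℝ) * (φ ⬝ᵥ (WE * H) *ᵥ φ))
      = B1Eq239Normalization.zConst (α * wK) (Fintype.card κ) (WE * (H + α • (Qks * Qk)))
          * Real.exp (-(1 / 2 : ℝ) * (wK * (ψ ⬝ᵥ
              (α • (1 : Matrix κ κ ℝ) - α ^ 2 • (Qk * (H + α • (Qks * Qk))⁻¹ * Qks)) *ᵥ ψ))) := by
  have hA : coordA (α * wK) Qk (WE * H) = WE * (H + α • (Qks * Qk)) := by
    unfold coordA
    rw [Matrix.mul_add, Matrix.mul_smul, ← Matrix.mul_assoc, hadj, Matrix.smul_mul, smul_smul]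
  have hA' : (coordA (α * wK) Qk (WE * H)).PosDef := by rw [hA]; exact hpos
  have hWE : IsUnit WE.det := (isUnit_det_of_posDef_mul hpos).1
  have hpt : ∀ φ : ι → ℝ,
      Real.exp (-(1 / 2 : ℝ) * ((α * wK) * ((ψ - Qk *ᵥ φ) ⬝ᵥ (ψ - Qk *ᵥ φ))))
          * Real.exp (-(1 / 2 : ℝ) * (φ ⬝ᵥ (WE * H) *ᵥ φ))
        = Real.exp (-(1 / 2 : ℝ) * coordExp (α * wK) Qk (WE * H) ψ φ) := by
    intro φ
    rw [← Real.exp_add, coordExp]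
    congr 1
    ring
  simp_rw [hpt]
  rw [integral_exp_coordExp hA' ψ, ← mul_assoc, coordSchur_eq hadj hWE ψ, B1Eq239Normalization.zConst_eq, hA]

end Coordinates

section StepDataDict

open B1RG242 B1Eq239Normalization

variable {ι κ ν : Type*} [Fintype ι] [Fintype κ] [Fintype ν] [DecidableEq ι] [DecidableEq κ] [DecidableEq ν]

omit [Fintype ν] [DecidableEq ν] in
/-- **(2.19) → (2.21) over `B1RG242.StepData`**: `T^ε_{a_k,L^k,A}[exp(−½⟨φ,Hφ⟩_ε)](ψ) = Z^ε_k · exp(−½⟨ψ,Δ^{(k)}ψ⟩_{L^kε})` with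
`Z^ε_k = zConst (S.α·wK) |κ| (WE(S.H + S.α·S.Pk))` (p15's first factor of (2.39)) and `Δ^{(k)} = S.Δk` (2.21) — the matrix that
`B1RG242` DEFINED is the one the integral PRODUCES. [cite: Balaban1982Higgs1, (2.19)–(2.21) p.610] -/
theorem display219 (S : StepData ℝ ι κ ν) {WE : Matrix ι ι ℝ} {wK : ℝ}
    (hadj : WE * S.Qks = wK • S.Qkᵀ) (hpos : (WE * (S.H + S.α • S.Pk)).PosDef) (ψ : κ → ℝ) :
    (S.α * wK / (2 * π)) ^ ((Fintype.card κ : ℝ) / 2)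
        * ∫ φ : ι → ℝ, Real.exp (-(1 / 2 : ℝ) * ((S.α * wK) * ((ψ - S.Qk *ᵥ φ) ⬝ᵥ (ψ - S.Qk *ᵥ φ))))
            * Real.exp (-(1 / 2 : ℝ) * (φ ⬝ᵥ (WE * S.H) *ᵥ φ))
      = zConst (S.α * wK) (Fintype.card κ) (WE * (S.H + S.α • S.Pk))
          * Real.exp (-(1 / 2 : ℝ) * (wK * (ψ ⬝ᵥ S.Δk *ᵥ ψ))) :=
  gaussStep WE S.H S.Qk S.Qks hadj hpos ψ

omit [DecidableEq ν] in
/-- (2.19) → (2.21) with the adjointness taken from `B1RG242.StepData.ScalarProducts` (uniform block weight `WK = wK·1`).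
[cite: Balaban1982Higgs1, (1.5) p.604, (2.19)–(2.21) p.610] -/
theorem display219_of_scalarProducts (S : StepData ℝ ι κ ν) {WE : Matrix ι ι ℝ} {wK : ℝ}
    {WM : Matrix ν ν ℝ} (E : S.ScalarProducts WE (wK • (1 : Matrix κ κ ℝ)) WM)
    (hpos : (WE * (S.H + S.α • S.Pk)).PosDef) (ψ : κ → ℝ) :
    (S.α * wK / (2 * π)) ^ ((Fintype.card κ : ℝ) / 2)
        * ∫ φ : ι → ℝ, Real.exp (-(1 / 2 : ℝ) * ((S.α * wK) * ((ψ - S.Qk *ᵥ φ) ⬝ᵥ (ψ - S.Qk *ᵥ φ))))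
            * Real.exp (-(1 / 2 : ℝ) * (φ ⬝ᵥ (WE * S.H) *ᵥ φ))
      = zConst (S.α * wK) (Fintype.card κ) (WE * (S.H + S.α • S.Pk))
          * Real.exp (-(1 / 2 : ℝ) * (wK * (ψ ⬝ᵥ S.Δk *ᵥ ψ))) := by
  refine display219 S (adj_matrix_of_forall fun φ ψ' => ?_) hpos ψ
  have h := E.adjk φ ψ'
  rwa [Matrix.smul_mulVec, Matrix.one_mulVec] at h

/-- **(2.18) COMPUTED over `B1RG242.StepData`**: `T^{L^kε}_{a,L,A}[exp(−½⟨θ,Δ^{(k)}θ⟩_{L^kε})](ψ) = Z^{(k),L^kε} · exp(−½⟨ψ,Δ^{(k+1)}ψ⟩_{L^{k+1}ε})`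
with `Z^{(k),L^kε} = zConst (S.β·wM) |ν| (wK(S.β·S.P + S.Δk))` (p15's second factor of (2.39); wM ↤ (L^{k+1}ε)^d, adjointness
`wK·Q^* = wM·Qᵀ`) and `Δ^{(k+1)} = β·1 − β²·QC^{(k)}Q^*` (`S.Ck` = C^{(k),L^kε} (2.30)). [cite: Balaban1982Higgs1, (2.18) p.610, (2.30) p.611] -/
theorem display218 (S : StepData ℝ ι κ ν) {wK wM : ℝ}
    (hadj : wK • S.Qs = wM • S.Qᵀ) (hpos : (wK • (S.β • S.P + S.Δk)).PosDef) (ψ : ν → ℝ) :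
    (S.β * wM / (2 * π)) ^ ((Fintype.card ν : ℝ) / 2)
        * ∫ θ : κ → ℝ, Real.exp (-(1 / 2 : ℝ) * ((S.β * wM) * ((ψ - S.Q *ᵥ θ) ⬝ᵥ (ψ - S.Q *ᵥ θ))))
            * Real.exp (-(1 / 2 : ℝ) * (θ ⬝ᵥ (wK • S.Δk) *ᵥ θ))
      = zConst (S.β * wM) (Fintype.card ν) (wK • (S.β • S.P + S.Δk))
          * Real.exp (-(1 / 2 : ℝ) * (wM * (ψ ⬝ᵥ
              (S.β • (1 : Matrix ν ν ℝ) - S.β ^ 2 • (S.Q * S.Ck * S.Qs)) *ᵥ ψ))) := by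
  have hadj' : (wK • (1 : Matrix κ κ ℝ)) * S.Qs = wM • S.Qᵀ := by
    rw [Matrix.smul_mul, Matrix.one_mul, hadj]
  have e1 : (wK • (1 : Matrix κ κ ℝ)) * S.Δk = wK • S.Δk := by rw [Matrix.smul_mul, Matrix.one_mul]
  have e2 : (wK • (1 : Matrix κ κ ℝ)) * (S.Δk + S.β • (S.Qs * S.Q)) = wK • (S.β • S.P + S.Δk) := by
    rw [Matrix.smul_mul, Matrix.one_mul, add_comm]; rfl
  have e3 : (S.Δk + S.β • (S.Qs * S.Q))⁻¹ = S.Ck := by rw [add_comm]; rfl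
  have h := gaussStep (wK • (1 : Matrix κ κ ℝ)) S.Δk S.Q S.Qs hadj' (by rw [e2]; exact hpos) ψ
  rw [e1, e2, e3] at h
  exact h

/-- **(2.18) is consistent with (2.21) one level up — for the COMPUTED integral**: under `QQ^* = 1`, `α + β ≠ 0` and
invertibility of `H + αP_k`, the form delivered by (2.18) is `γ·1 − γ²·Q_{k+1}G^ε_{k+1}Q^*_{k+1}` = (2.21) at k + 1
(`B1RG242.StepData.display221_succ`). [cite: Balaban1982Higgs1, (2.18)/(2.21) p.610, (2.13) p.609] -/
theorem display218_221 (S : StepData ℝ ι κ ν) {wK wM : ℝ}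
    (hadj : wK • S.Qs = wM • S.Qᵀ) (hpos : (wK • (S.β • S.P + S.Δk)).PosDef)
    (hQ : S.Q * S.Qs = 1) (hαβ : S.α + S.β ≠ 0) (hG : IsUnit (S.H + S.α • S.Pk)) (ψ : ν → ℝ) :
    (S.β * wM / (2 * π)) ^ ((Fintype.card ν : ℝ) / 2)
        * ∫ θ : κ → ℝ, Real.exp (-(1 / 2 : ℝ) * ((S.β * wM) * ((ψ - S.Q *ᵥ θ) ⬝ᵥ (ψ - S.Q *ᵥ θ))))
            * Real.exp (-(1 / 2 : ℝ) * (θ ⬝ᵥ (wK • S.Δk) *ᵥ θ))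
      = zConst (S.β * wM) (Fintype.card ν) (wK • (S.β • S.P + S.Δk))
          * Real.exp (-(1 / 2 : ℝ) * (wM * (ψ ⬝ᵥ
              (S.γ • (1 : Matrix ν ν ℝ) - S.γ ^ 2 • (S.Qk1 * S.Gk1 * S.Qk1s)) *ᵥ ψ))) := by
  have hC : IsUnit (S.β • S.P + S.Δk) := by
    have hwK : IsUnit (wK • (1 : Matrix κ κ ℝ)).det ∧ IsUnit (S.β • S.P + S.Δk).det := by
      refine isUnit_det_of_posDef_mul ?_
      rw [Matrix.smul_mul, Matrix.one_mul]; exact hpos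
    exact (Matrix.isUnit_iff_isUnit_det _).mpr hwK.2
  rw [display218 S hadj hpos ψ, S.display221_succ hQ hαβ hG hC]

end StepDataDict

/-! ## §3  The bridge to `B1Eq221GaussStep`: the intrinsic form `schurForm` in coordinates -/

section Bridge

open B1Eq221GaussStep

variable {V : Type*} [NormedAddCommGroup V] [InnerProductSpace ℝ V]
variable {X Y : Type*} [Fintype Y]
variable {ι κ' : Type*} [Fintype ι] [Fintype κ'] [DecidableEq ι]

/-- A LINEAR COORDINATE DICTIONARY between the carriers of `B1RT`/`B1Eq221GaussStep` and integration coordinates: `e`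
coordinates on the fine fields `X → V`, BLOCK-ISOMETRIC coordinates `f` on `Y → V` (so `|ψ(y) − (Q_kφ)(y)|²` of (2.10) is a
dot product), `K` the matrix of the block average `q` and `M` the matrix of the form `B`. [cite: Balaban1982Higgs1, (1.5) p.604, (2.10)–(2.11) p.609] -/
structure CoordDict (κ : ℝ) (q : (X → V) →ₗ[ℝ] (Y → V)) (B : (X → V) →ₗ[ℝ] (X → V) →ₗ[ℝ] ℝ)
    (e : (X → V) →ₗ[ℝ] (ι → ℝ)) (f : (Y → V) →ₗ[ℝ] (κ' → ℝ)) (K : Matrix κ' ι ℝ) (M : Matrix ι ι ℝ) :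
    Prop where
  /-- `f` is isometric: `Σ_y u(y)·v(y) = (fu)·(fv)` -/
  isom : ∀ u v : Y → V, ∑ y, ⟪u y, v y⟫_ℝ = f u ⬝ᵥ f v
  /-- `K` is the block average in coordinates: `f(qφ) = K(eφ)` -/
  avg : ∀ φ, f (q φ) = K *ᵥ e φ
  /-- `M` is the form in coordinates: `B φ χ = (eφ)ᵀM(eχ)` -/
  form : ∀ φ χ, B φ χ = e φ ⬝ᵥ M *ᵥ e χ

variable {κ : ℝ} {q : (X → V) →ₗ[ℝ] (Y → V)} {B : (X → V) →ₗ[ℝ] (X → V) →ₗ[ℝ] ℝ}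
  {e : (X → V) →ₗ[ℝ] (ι → ℝ)} {f : (Y → V) →ₗ[ℝ] (κ' → ℝ)} {K : Matrix κ' ι ℝ} {M : Matrix ι ι ℝ}

omit [DecidableEq ι] in
/-- The joint exponent in coordinates: `jointExp κ q B ψ φ = coordExp κ K M (fψ) (eφ)`. [cite: Balaban1982Higgs1, (2.19) p.610] -/
theorem CoordDict.jointExp_eq (D : CoordDict κ q B e f K M) (ψ : Y → V) (φ : X → V) :
    jointExp κ q B ψ φ = coordExp κ K M (f ψ) (e φ) := by
  unfold jointExp coordExp
  have h1 : ∑ y, ‖ψ y - q φ y‖ ^ 2 = f (ψ - q φ) ⬝ᵥ f (ψ - q φ) := by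
    rw [← D.isom]
    exact Finset.sum_congr rfl fun y _ => by rw [Pi.sub_apply, real_inner_self_eq_norm_sq]
  rw [h1, map_sub, D.avg, D.form]

omit [DecidableEq ι] in
/-- The φφ-form in coordinates: `jointA κ q B φ χ = (eφ)ᵀ coordA (eχ)`. [cite: Balaban1982Higgs1, (2.20) p.610] -/
theorem CoordDict.jointA_eq (D : CoordDict κ q B e f K M) (φ χ : X → V) :
    jointA κ q B φ χ = e φ ⬝ᵥ (coordA κ K M) *ᵥ e χ := by
  unfold jointA coordA
  rw [D.isom, D.avg, D.avg, D.form, Matrix.add_mulVec, dotProduct_add, Matrix.smul_mulVec,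
    dotProduct_smul, ← Matrix.mulVec_mulVec, Matrix.dotProduct_mulVec (e φ) Kᵀ, Matrix.vecMul_transpose,
    smul_eq_mul]
  ring

omit [DecidableEq ι] in
/-- The cross term in coordinates: `source κ q ψ χ = κ(Kᵀfψ)·(eχ)`. [cite: Balaban1982Higgs1, (2.19) p.610] -/
theorem CoordDict.source_eq (D : CoordDict κ q B e f K M) (ψ : Y → V) (χ : X → V) :
    source κ q ψ χ = κ * ((Kᵀ *ᵥ f ψ) ⬝ᵥ e χ) := by
  unfold source
  rw [D.isom, D.avg, Matrix.mulVec_transpose, ← Matrix.dotProduct_mulVec]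

/-- A stationary point of `B1Eq221GaussStep` has as coordinates the coordinate minimiser `κ·A^{−1}Kᵀ(fψ)` (= the background
field (3.29), `minimiser_eq_background`), when `e` is onto and `A` is positive definite. [cite: Balaban1982Higgs1, (3.10) p.614, (3.29) p.617] -/
theorem CoordDict.coord_of_isStationary (D : CoordDict κ q B e f K M) (he : Function.Surjective e)
    (hA : (coordA κ K M).PosDef) {ψ : Y → V} {φ₀ : X → V} (hst : IsStationary κ q B ψ φ₀) :
    e φ₀ = κ • ((coordA κ K M)⁻¹ *ᵥ (Kᵀ *ᵥ f ψ)) := by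
  set A := coordA κ K M with hAdef
  have hAT : Aᵀ = A := by
    have h := hA.isHermitian
    rwa [Matrix.IsHermitian, Matrix.conjTranspose_eq_transpose_of_trivial] at h
  have hAe : A *ᵥ e φ₀ = κ • (Kᵀ *ᵥ f ψ) := by
    refine dotProduct_eq _ _ fun v => ?_
    obtain ⟨χ, rfl⟩ := he v
    have h := hst χ
    rw [D.jointA_eq, D.source_eq] at h
    rw [smul_dotProduct, smul_eq_mul, ← h, Matrix.dotProduct_mulVec, ← Matrix.mulVec_transpose, hAT]
  have hu : IsUnit A.det := isUnit_iff_ne_zero.mpr hA.det_pos.ne'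
  calc e φ₀ = A⁻¹ *ᵥ (A *ᵥ e φ₀) := by
        rw [Matrix.mulVec_mulVec, Matrix.nonsing_inv_mul _ hu, Matrix.one_mulVec]
    _ = κ • (A⁻¹ *ᵥ (Kᵀ *ᵥ f ψ)) := by rw [hAe, Matrix.mulVec_smul]

/-- **The two computations agree on the form**: under a coordinate dictionary (`e` onto, `A` positive definite) the intrinsic
`⟨ψ,Δ^{(k)}ψ⟩` of `B1Eq221GaussStep` (`schurForm`, value of the joint exponent at its stationary point) equals the coordinate
Schur complement `coordSchur κ K M (fψ)` of `gaussStep`/`display219` (= `wK·ψᵀ StepData.Δk ψ` by `coordSchur_eq`).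
[cite: Balaban1982Higgs1, (2.21) p.610] -/
theorem CoordDict.schurForm_eq (D : CoordDict κ q B e f K M) (he : Function.Surjective e)
    (hA : (coordA κ K M).PosDef) {ψ : Y → V} {φ₀ : X → V} (hst : IsStationary κ q B ψ φ₀) :
    schurForm κ q ψ φ₀ = coordSchur κ K M (f ψ) := by
  unfold schurForm coordSchur
  have h1 : ∑ y, ‖ψ y‖ ^ 2 = f ψ ⬝ᵥ f ψ := by
    rw [← D.isom]
    exact Finset.sum_congr rfl fun y _ => by rw [real_inner_self_eq_norm_sq]
  rw [h1, D.source_eq, D.coord_of_isStationary he hA hst, dotProduct_smul, smul_eq_mul]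
  ring

end Bridge

end Literature.MathematicalPhysics.QuantumFieldTheory.Balaban1983to89.B1Eq221Dictionary
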